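import Literature.MathematicalPhysics.QuantumFieldTheory.Balaban1983to89.Beta.RemainderLocality
import Literature.MathematicalPhysics.QuantumFieldTheory.Balaban1983to89.Beta.OneStepKernelFamily

/-!
# Beta / RemainderExplicitRoad — BINDER-OWNERS row D4 «RemainderConst leaves for Bałaban's split», ROAD P3 (the
# REDUCTION ROAD of co-owner #3, unit `b2b-balaban-beta-d4-p3`): the END of the road as ONE kernel theorem —
# (D4) ⇐ ONE residual printed lemma (R) over an EXPLICIT test-configuration carrier + the carrier's k-uniform decay (E)
# + the carrier's entrywise volume limit (V) + the four numeric conditions of the printed chain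

HONEST FRAMING (page 1 of everything the β sub-cell writes): discharging `BetaPertH` makes Bałaban's UV stability
UNCONDITIONAL — a real constructive-QFT result; it is NOT the continuum limit and NOT the Clay problem.  HONEST DEPENDENCY
(cell reorg 2026-08-19, verbatim): «continuum YM on T⁴ ⇐ BetaPertH ∧ nine spine estimates (0/9 proved); BetaPertH ⇐ (D1) ∧
(D4) ∧ CAP+tail; G-an2-4 gates asym, D1 and NE2/3/4.»  THIS MODULE INSTANTIATES NO BINDER AND SAYS NOTHING ABOUT BAŁABAN'S
β-FUNCTIONS: it is `[folklore]` bookkeeping over the UNMODIFIED Literature modules `Beta.RemainderLocality`,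
`Beta.RemainderLimitTorus`, `Beta.RemainderChainTorus`, `Beta.RemainderChainLattice`, `Beta.RemainderChain`,
`Beta.OneStepKernelFamily` (imported BY NAME); no `sorry`, no axiom, no cited fact.

ABSOLUTE RULE (cell charter, verbatim): "No internally-minted statement may enter as a cited fact. Every hypothesis is
either kernel-proved in this package or a verbatim quotation of a PUBLISHED theorem with page reference. The manuscript(s)
under audit are NOT citable for their own disputed steps — they are the thing under adjudication; programme-internal
(2001/route/tribunal) claims are never citable."  The `[cite: …]` tags below are CONTEXT ONLY (which printed display a
hypothesis field has the SHAPE of); no tag imports a fact.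

## What row D4 is (by tree name) and what road P3 does

Row D4 = the binder pair `(hrem : RemainderChain.RemainderConst Sβ γ₀ rr) (hr : rr ≤ B12Normalization.stepBal N Lc)` of the
wall's END `OneStepKernelFamily.endpointExistence_of_D1Drift`, supplied in the tree by the row owner's (lineage an4) chain
`RemainderLocality.ChainTFac.abs_beta1_le` with `rr := c.ε₁ · remCoeffL d M c α₂ B₃`, whose leaf list
`RemainderLocality.PolLeavesTFac` carries, PER scale `k` and history `p`, the [II]-side step objects and Lemma 3 (2.38), the
[I] (4.4) seam and analyticity, the (4.35) representation `hrepr` of the polarization terms as second derivatives ALONG TEST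
CONFIGURATIONS `hn n X x`, the test-configuration decay `hh` ([I] p. 282, there from [15] (190)), the printed locality (F1)
and the restricted test-configuration volume limit (F2) (`hconv`).

ROAD P3 (cell file `HOME/beta/skeletons/D4-b2b-balaban-beta-d4-p3.md`) CUTS that leaf list differently:
* the test configurations are NOT data supplied together with Bałaban's step objects but an EXPLICIT CARRIER
  `ExplicitCarrier d M` fixed in advance (on the road: the columns of the typed `U = 1` block-averaging KKT solution
  operator `Beta.KernelSpecInstance.wH`, periodised to the torus and read in the (4.4)-normed space — [I] p. 281 (4.3):
  the B-derivatives at `B = 0` of `𝐄^{(j)}(X, U_j(□₀, exp iB))` are derivatives of `𝐄^{(j)}(X, exp iξ𝐀)` *"i.e. the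
  function with 𝐔 = 1, 𝐉 = 0"* along `⟨δ^{n(p)}/δB^{n(p)} 𝐇_j(□₀, 0), ⊗ B_i⟩`, the derivatives AT ZERO of the minimiser);
* their k-UNIFORM decay `ExplicitCarrier.Decay B₃ δ₀` (the shape of `PolLeavesTFac.hh`) is a SEPARATE hypothesis (E) about
  the explicit carrier only — on the road supplied by the tree's `Summit.…GAN24.FineReadoutDecay.exists_wH_decay` (d + 1 = 4,
  ONE `(κ₀, C)` for every level) through the units/restriction leaves (E3)/(E4) of the skeleton, or, in the coordinator's
  words for this seat, by «CAP-k computational rows plus a monotone majorant» (certified per-level strip constants for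
  `j ≤ j₀` + the (CONV-C) one-step rate for the tail, then `Decay.mono`);
* their entrywise volume limit `ExplicitCarrier.Limit` (the shape of `PolLeavesTFac.hconv`, (F2)) is a SEPARATE hypothesis
  (V) about the explicit carrier only — on the road supplied by `RemainderLocalitySockets.hconv_periodise₂_cubes`;
* EVERYTHING ELSE of the leaf list — Bałaban's step objects `W n : TorusStep d (N n)`, the restriction property and the
  (2.13) representation, Lemma 3 (2.38)_ℓ, the (4.4) seam `emb/hemb/hcomp`, analyticity `han`, the representation `hrepr`
  NOW ALONG THE EXPLICIT TEST CONFIGURATIONS, the printed locality (F1) `F/hF/hfac` read through the carrier's restriction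
  maps, and the identification `ha` of the infinite-volume terms — is ONE hypothesis structure `Residual 𝔈 a c ℓ α₂`:
  THE RESIDUAL PRINTED INPUT OF ROW D4 ON ROAD P3, stated once, by name (`ResidualChain` at chain level).
The END of the road: `ResidualChain.abs_beta1_le` — (R) ∧ (E) ∧ (V) ∧ `CondsL ∧ R22gen ∧ SignsL` ⟹
`RemainderConst Sβ γ (c.ε₁ · remCoeffL d M c α₂ B₃)` (= `hrem`, the SAME fully valued coefficient as every an4 carrier), and
`endpointExistence_of_residualChain_D1Drift` — the wall's END `OneStepKernelFamily.endpointExistence_of_D1Drift` with its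
(D4) pair supplied from (R) ∧ (E) ∧ (V) ∧ numerics (`hr` stays the printed-type restriction on ε₁, kernel-satisfiable by
`RemainderChainKP.exists_eps1_lt_and_le`).  `Decay.mono` is the monotone-majorant socket: any majorant pair
`(B₃′ ≥ B₃, δ₀′ ≤ δ₀)` of per-level constants feeds the chain.

WHAT THIS FILE DOES NOT DO: construct Bałaban's step objects, prove Lemma 3, the seam, analyticity, (4.35) or (F1) for
them (that is (R) — size XL, no owner in the cell, BINDER-OWNERS row D4 / `BETA/REMAINDER-BETA.md` §10 V1); construct the
concrete (4.4)-normed carrier from `wH` (skeleton leaves (E1)/(E3)/(E4)/(V2)); discharge `BetaPertH`.  NOT summit progress.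
-/

namespace Summit.QuantumFields.BalabanUV.Beta.RemainderExplicitRoad

open Literature.MathematicalPhysics.QuantumFieldTheory.Balaban1983to89
open Literature.MathematicalPhysics.QuantumFieldTheory.Balaban1983to89.Beta
open FlowStep FlowStepRuns DagBinding
open B13ScaleTransfer (Pt)
open B13Resummation (SpRestr Repr213)
open TreeLengthTorus (TPt TDom proj)
open TreeLengthTorusGeometry (TorusStep)
open B12Decay510 (mixedDeriv)
open B12Decay510Torus (distCT nearT distCT_nonneg)
open Beta.RemainderChain (RemainderConst)
open Beta.RemainderChainLattice (CondsL SignsL remCoeffL)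
open Beta.RemainderLimitTorus (LDom tproj limKernel)
open Beta.RemainderLocality (PolLeavesTFac ChainTFac)
open Metric Filter Topology

noncomputable section

variable {d : ℕ}

/-! ## §1 The EXPLICIT CARRIER of the test configurations (road P3's cut of `PolLeavesTFac`) -/

/-- **EXPLICIT TEST-CONFIGURATION CARRIER** on the exhausting family of tori of the remainder chain (tori with `N n · M` sites
per direction, cubes of side `M`, localization domains `TDom d (N n)` — the conventions of `RemainderLimitTorus` /
`RemainderLocality`): the torus sizes `N n → ∞`, the test-vector spaces `Wn n` (on the road: the (4.4)-normed spaces of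
[Balaban1987RG1] p. 281), THE TEST CONFIGURATIONS `tc n X x : Wn n` (on the road: the (4.4)-space images of the columns
`⟨δ𝐇_j(□₀, 0)/δB, δ_x⟩` of the linearised `U = 1` minimiser, [Balaban1987RG1] (4.3) p. 281 and p. 282 — EXPLICIT, k-indexed,
background-free), the restricted-configuration spaces `V Y`, the restriction maps `r n Y` and the infinite-volume restricted
test configurations `t Y x` of the printed locality (F1)/(F2).  DATA, no hypothesis.  Everything Bałaban's densities must
satisfy RELATIVE to this carrier is the separate structure `Residual`. [folklore] -/
structure ExplicitCarrier (d M : ℕ) [NeZero M] where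
  /-- number of cubes per direction of the n-th torus -/
  N : ℕ → ℕ
  [hN : ∀ n, NeZero (N n)]
  /-- the tori exhaust `ℤ^d` -/
  hNlim : Tendsto N atTop atTop
  /-- the test-vector spaces (road: the (4.4)-normed configuration spaces) -/
  Wn : ℕ → Type
  [instW : ∀ n, NormedAddCommGroup (Wn n)]
  [instWs : ∀ n, NormedSpace ℂ (Wn n)]
  /-- THE TEST CONFIGURATIONS `h_n(X̄; x)` — explicit -/
  tc : (n : ℕ) → TDom d (N n) → TPt d (N n * M) → Wn n
  /-- restricted-configuration spaces of the printed locality (F1) -/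
  V : LDom d → Type
  [instV : ∀ Y, NormedAddCommGroup (V Y)]
  [instVs : ∀ Y, NormedSpace ℂ (V Y)]
  /-- the restriction maps (F1) -/
  r : (n : ℕ) → (Y : LDom d) → Wn n →L[ℂ] V Y
  /-- the infinite-volume restricted test configurations (F2) -/
  t : (Y : LDom d) → Pt d → V Y

namespace ExplicitCarrier

variable {M : ℕ} [NeZero M] (𝔈 : ExplicitCarrier d M)

/-- The carried `NeZero (N n)` witnesses. [folklore] -/
instance instNeZeroN (n : ℕ) : NeZero (𝔈.N n) := 𝔈.hN n

/-- The carried normed-group structures of the test-vector spaces. [folklore] -/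
instance instNormedAddCommGroupWn (n : ℕ) : NormedAddCommGroup (𝔈.Wn n) := 𝔈.instW n

/-- The carried ℂ-normed-space structures of the test-vector spaces. [folklore] -/
instance instNormedSpaceWn (n : ℕ) : NormedSpace ℂ (𝔈.Wn n) := 𝔈.instWs n

/-- The carried normed-group structures of the restricted-configuration spaces. [folklore] -/
instance instNormedAddCommGroupV (Y : LDom d) : NormedAddCommGroup (𝔈.V Y) := 𝔈.instV Y

/-- The carried ℂ-normed-space structures of the restricted-configuration spaces. [folklore] -/
instance instNormedSpaceV (Y : LDom d) : NormedSpace ℂ (𝔈.V Y) := 𝔈.instVs Y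

/-- **(E) THE k-UNIFORM DECAY OF THE EXPLICIT TEST CONFIGURATIONS** — the shape of `PolLeavesTFac.hh` ([Balaban1987RG1]
p. 282: *"can be estimated by B₃∏|B_i|, and if one of the functions B_i is localized outside the domain X, then we have the
additional exponential factor exp(−δ₀dist^{(ξ)}(X, supp B_i))"*), as a predicate ON THE CARRIER ALONE: ONE pair `(B₃, δ₀)`
for every torus index, domain and site.  On road P3 this is NOT taken from [15] (190): it is the tree's uniform decay of
the typed `U = 1` minimiser columns (`GAN24.FineReadoutDecay.exists_wH_decay`) read through the units/restriction leaves
(printed context: [Balaban1987RG1] p. 282). [folklore] -/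
def Decay (B₃ δ₀ : ℝ) : Prop :=
  ∀ n (X : TDom d (𝔈.N n)) (x : TPt d (𝔈.N n * M)),
    ‖𝔈.tc n X x‖ ≤ B₃ * Real.exp (-δ₀ * distCT (𝔈.N n) M x (nearT (M := M) x X))

/-- **(V) THE ENTRYWISE VOLUME LIMIT OF THE EXPLICIT TEST CONFIGURATIONS** — the shape of `PolLeavesTFac.hconv` ((F2): the
restricted test configurations of the reductions `Y mod N_n` converge as the tori exhaust `ℤ^d`), as a predicate ON THE
CARRIER ALONE.  On road P3: the socket `RemainderLocalitySockets.hconv_periodise₂_cubes` (periodisations of a decaying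
`ℤ^d` kernel; printed context: [Balaban1987RG1] (5.1) p. 292, (1.21) p. 264). [folklore] -/
def Limit : Prop :=
  ∀ (Y : LDom d) (x : Pt d),
    Tendsto (fun n => 𝔈.r n Y (𝔈.tc n (tproj (𝔈.N n) Y) (proj (𝔈.N n * M) x))) atTop (𝓝 (𝔈.t Y x))

/-- **THE MONOTONE-MAJORANT SOCKET**: decay with constants `(B₃, δ₀)` implies decay with any majorant pair `B₃ ≤ B₃′`,
`0 ≤ δ₀′ ≤ δ₀` (`0 ≤ B₃′`).  Per-level certified constants `(B₃(j), δ₀(j))` (a «CAP row» for the explicit operator) + a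
tail majorant therefore feed the chain with ONE pair; and the chain's rate `c.δ₀` may be any positive number below the
carrier's rate. [folklore] -/
theorem Decay.mono {B₃ B₃' δ₀ δ₀' : ℝ} (h : 𝔈.Decay B₃ δ₀) (hB : B₃ ≤ B₃') (hB' : 0 ≤ B₃') (hδ : δ₀' ≤ δ₀)
    (hδ' : 0 ≤ δ₀') : 𝔈.Decay B₃' δ₀' := by
  intro n X x
  have hD : 0 ≤ distCT (𝔈.N n) M x (nearT (M := M) x X) := distCT_nonneg _ _
  calc ‖𝔈.tc n X x‖ ≤ B₃ * Real.exp (-δ₀ * distCT (𝔈.N n) M x (nearT (M := M) x X)) := h n X x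
    _ ≤ B₃' * Real.exp (-δ₀ * distCT (𝔈.N n) M x (nearT (M := M) x X)) :=
        mul_le_mul_of_nonneg_right hB (Real.exp_nonneg _)
    _ ≤ B₃' * Real.exp (-δ₀' * distCT (𝔈.N n) M x (nearT (M := M) x X)) := by
        refine mul_le_mul_of_nonneg_left (Real.exp_le_exp.mpr ?_) hB'
        have _ := hδ'
        nlinarith

/-- A level-indexed family of per-level constants bounded by a common majorant gives ONE decay pair for a level-indexed
family of carriers (the «CAP rows for `j ≤ j₀` + tail majorant» bookkeeping in one line). [folklore] -/
theorem Decay.uniform_of_levelwise {𝔈k : ℕ → ExplicitCarrier d M} {Bk δk : ℕ → ℝ} {B₃ δ₀ : ℝ}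
    (h : ∀ k, (𝔈k k).Decay (Bk k) (δk k)) (hB : ∀ k, Bk k ≤ B₃) (hB₃ : 0 ≤ B₃) (hδ : ∀ k, δ₀ ≤ δk k)
    (hδ₀ : 0 ≤ δ₀) : ∀ k, (𝔈k k).Decay B₃ δ₀ :=
  fun k => (h k).mono (𝔈k k) (hB k) hB₃ (hδ k) hδ₀

end ExplicitCarrier

/-! ## §2 (R) THE RESIDUAL PRINTED INPUT, relative to an explicit carrier -/

/-- **(R) THE RESIDUAL PRINTED INPUT OF ROW D4 ON ROAD P3** for ONE scale and ONE history, relative to the explicit carrier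
`𝔈` and with infinite-volume terms `a`: `RemainderLocality.PolLeavesTFac` with its explicit fields (`N`, `Wn`, `hn`, `V`,
`r`, `t`) PINNED to the carrier and its carrier-only hypotheses (`hh`, `hconv`) REMOVED.  What is left is exactly what
Bałaban's densities must satisfy and print asserts: the [II]-side step objects on each torus (`W`) with the restriction
property of the spaces (p. 15) and the representation (2.13) (`hsp`, `hrep`) and LEMMA 3 (2.38)_ℓ (`h238`); the [I] (4.4)
seam (`emb`, `hemb`, `hcomp`: the α₂-ball of the (4.4)-space is mapped into `𝐔ᶜ(X, α₀, α₁)`, (3.32)/(3.37) p. 277 and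
(4.2) p. 281) and analyticity on the α₂-ball (`han`, (4.4) p. 281); the polarization terms `E2n` and their representation
(4.3)/(4.14)/(4.35) as second derivatives ALONG THE CARRIER'S TEST CONFIGURATIONS (`hrepr`: the one clause that ties
Bałaban's `δ𝐇_j(□₀, 0)/δB` to the explicit columns — the `U = 1` minimiser READING the D1 row also carries); the printed
locality (1.7) as factorization through the carrier's restriction maps (`F`, `hF`, `hfac`, [I] p. 261/263); and the
identification `ha` of the infinite-volume terms.  A HYPOTHESIS structure; size XL behind it (the cell's NODE O/A/B of
`SKELETON-D4-P1.md`); nothing of it is discharged anywhere in the tree for Bałaban's densities.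
[cite: Balaban1988RG2Cluster, Lemma 3 (2.38) p.20 and (2.13) p.14; Balaban1987RG1, (4.3)-(4.4) p.281, (4.35) p.290, (1.7) p.261] -/
structure Residual {M : ℕ} [NeZero M] (𝔈 : ExplicitCarrier d M) (a : LDom d → Pt d → ℝ) (c : B13.Consts)
    (ℓ α₂ : ℝ) where
  /-- Bałaban's [II]-side step data on the n-th torus (objects) -/
  W : (n : ℕ) → TorusStep d (𝔈.N n)
  /-- restriction property of the spaces, [II] p. 15 -/
  hsp : ∀ n, SpRestr (W n).toStepData (W n).geom
  /-- the (2.13) representation, [II] p. 14 -/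
  hrep : ∀ n, Repr213 (W n).toStepData (W n).geom
  /-- LEMMA 3 (2.38)_ℓ, [II] p. 20 -/
  h238 : ∀ n, B13.Bound238With (W n).toStepData c ℓ
  /-- `𝐄^{(k+1)}(X)` read on the carrier's test-vector space ((4.2)/(4.4)) -/
  EXn : (n : ℕ) → TDom d (𝔈.N n) → 𝔈.Wn n → ℂ
  /-- the (4.4) seam: the test-vector space into the configuration space -/
  emb : (n : ℕ) → TDom d (𝔈.N n) → 𝔈.Wn n → (W n).Φ
  /-- the α₂-ball lands in `𝐔ᶜ(X, α₀, α₁)` ((3.32), (3.37), (4.2)) -/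
  hemb : ∀ n X, ∀ v ∈ ball (0 : 𝔈.Wn n) α₂, emb n X v ∈ (W n).sp2 X
  /-- `EXn` IS `𝐄^{(k+1)}(X)` composed with the seam -/
  hcomp : ∀ n X v, EXn n X v = (W n).Ek1 X (emb n X v)
  /-- the localized polarization terms on the torus -/
  E2n : (n : ℕ) → TDom d (𝔈.N n) → TPt d (𝔈.N n * M) → TPt d (𝔈.N n * M) → ℝ
  /-- analyticity on the α₂-ball, (4.4) p. 281 -/
  han : ∀ n X, AnalyticOnNhd ℂ (EXn n X) (ball 0 α₂)
  /-- (4.3)/(4.14)/(4.35): second derivatives ALONG THE EXPLICIT TEST CONFIGURATIONS -/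
  hrepr : ∀ n X x y, E2n n X x y = (mixedDeriv (EXn n X) (𝔈.tc n X x) (𝔈.tc n X y)).re
  /-- (F1) the restricted functionals of the printed locality (1.7) -/
  F : (Y : LDom d) → 𝔈.V Y → ℂ
  /-- (F1) analytic at 0 -/
  hF : ∀ Y, AnalyticAt ℂ (F Y) 0
  /-- (F1) factorization through the carrier's restriction, eventually in n -/
  hfac : ∀ Y : LDom d, ∀ᶠ n in atTop, ∀ v ∈ ball (0 : 𝔈.Wn n) α₂, EXn n (tproj (𝔈.N n) Y) v = F Y (𝔈.r n Y v)
  /-- identification of the infinite-volume terms -/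
  ha : ∀ (Y : LDom d) (z : Pt d), a Y z = (mixedDeriv (F Y) (𝔈.t Y 0) (𝔈.t Y z)).re

namespace Residual

variable {M : ℕ} [NeZero M] {𝔈 : ExplicitCarrier d M} {a : LDom d → Pt d → ℝ} {c : B13.Consts} {ℓ α₂ : ℝ}

/-- **(R) ∧ (E) ∧ (V) IS the row owner's leaf list** `RemainderLocality.PolLeavesTFac d M a c ℓ α₂ B₃` — the test
configurations, their decay and their volume limit supplied from the explicit carrier, everything else from the residual.
Pure repackaging. [folklore] -/
def toPolLeavesTFac (R : Residual 𝔈 a c ℓ α₂) {B₃ : ℝ} (hE : 𝔈.Decay B₃ c.δ₀) (hV : 𝔈.Limit) :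
    PolLeavesTFac d M a c ℓ α₂ B₃ where
  N := 𝔈.N
  hN := 𝔈.hN
  hNlim := 𝔈.hNlim
  W := R.W
  hsp := R.hsp
  hrep := R.hrep
  h238 := R.h238
  Wn := 𝔈.Wn
  instW := 𝔈.instW
  instWs := 𝔈.instWs
  EXn := R.EXn
  emb := R.emb
  hemb := R.hemb
  hcomp := R.hcomp
  hn := 𝔈.tc
  E2n := R.E2n
  han := R.han
  hrepr := R.hrepr
  hh := hE
  V := 𝔈.V
  instV := 𝔈.instV
  instVs := 𝔈.instVs
  F := R.F
  hF := R.hF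
  r := 𝔈.r
  hfac := R.hfac
  t := 𝔈.t
  hconv := hV
  ha := R.ha

end Residual

/-! ## §3 The chain level: one explicit carrier per scale, one residual per scale and history; the END `hrem` -/

/-- **(R) AT CHAIN LEVEL — THE RESIDUAL PRINTED INPUT OF ROW D4 ON ROAD P3, STATED ONCE**: for the β-family `β` with
one-loop split `S` on the boxes `]0,γ]^{k+1}`, relative to a SCALE-INDEXED family of explicit carriers `𝔈 k` (the test
configurations depend on the scale through the fine lattice `η = L^{−k}`, never on the history): the infinite-volume
localized polarization terms `A1 k p` of the (2.13)-half, the dictionary clause `beta1_eq` ((1.20)/(1.22) on the DEFINED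
limit kernel `limKernel (A1 k p)` — the identification burden shared with row D1's `hβ`), and for every scale and history a
`Residual (𝔈 k) (A1 k p) c ℓ α₂` with THE SAME `c, ℓ, α₂` (the printed constants are k-free BY DEFINITION, cell record
`BETA/REMAINDER-BETA.md` §2).  A HYPOTHESIS structure: the one named residual of the road.
[cite: Balaban1987RG1, (1.20)-(1.22) p.264; Balaban1988RG2Cluster, Lemma 3 (2.38) p.20] -/
structure ResidualChain (d M : ℕ) [NeZero M] (μ ν : Fin d) {β : HBeta} (S : B12Beta.OneLoopSplit β) (γ : ℝ)
    (c : B13.Consts) (ℓ α₂ : ℝ) (𝔈 : ℕ → ExplicitCarrier d M) where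
  /-- infinite-volume localized polarization terms of the (2.13)-half at scale k + 1, history p -/
  A1 : (k : ℕ) → (Fin (k + 1) → ℝ) → LDom d → Pt d → ℝ
  /-- the (1.20)/(1.22) dictionary: β¹ IS the second moment of the limit kernel -/
  beta1_eq : ∀ k p, p ∈ B12Beta.HistBox γ k →
    S.β1 k p = B12Beta.secondMoment (fun _ _ => limKernel (A1 k p)) μ ν
  /-- the residual printed input at scale k, history p, relative to the carrier `𝔈 k` -/
  res : ∀ k p, p ∈ B12Beta.HistBox γ k → Residual (𝔈 k) (A1 k p) c ℓ α₂

namespace ResidualChain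

variable {M : ℕ} [NeZero M] {μ ν : Fin d} {β : HBeta} {S : B12Beta.OneLoopSplit β} {γ : ℝ} {c : B13.Consts}
  {ℓ α₂ : ℝ} {𝔈 : ℕ → ExplicitCarrier d M}

/-- **(R) ∧ (E) ∧ (V) IS the row owner's chain** `RemainderLocality.ChainTFac d M μ ν S γ c ℓ α₂ B₃`. [folklore] -/
def toChainTFac (R : ResidualChain d M μ ν S γ c ℓ α₂ 𝔈) {B₃ : ℝ} (hE : ∀ k, (𝔈 k).Decay B₃ c.δ₀)
    (hV : ∀ k, (𝔈 k).Limit) : ChainTFac d M μ ν S γ c ℓ α₂ B₃ where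
  A1 := R.A1
  beta1_eq := R.beta1_eq
  leaves := fun k p hp => (R.res k p hp).toPolLeavesTFac (hE k) (hV k)

/-- **THE END OF ROAD P3 — `hrem`**: the residual printed input (R), the k-uniform decay (E) and the volume limit (V) of the
explicit test configurations, the four numeric conditions `CondsL d c ℓ`, the closing relation `(1 − 10δ)ℓ = 1` and the
printed signs give `|β¹_{k+1}(g_0,…,g_k)| ≤ ε₁ · K_rem,L` for EVERY scale and EVERY history in `]0,γ]^{k+1}`, with the row
owner's closed, ε₁-free, k-free, history-free, volume-free coefficient `remCoeffL d M c α₂ B₃`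
(`RemainderLocality.ChainTFac.abs_beta1_le` BY NAME).  O(ε₁), not O(g_k), not O(γ²).
[cite: Balaban1988RG2Cluster, (2.38) p.20 and (2.41) p.21; Balaban1987RG1, (5.10) p.293 and (1.22) p.264] -/
theorem abs_beta1_le (R : ResidualChain d M μ ν S γ c ℓ α₂ 𝔈) {B₃ : ℝ} (hE : ∀ k, (𝔈 k).Decay B₃ c.δ₀)
    (hV : ∀ k, (𝔈 k).Limit) (hC : CondsL d c ℓ) (h22 : c.R22gen ℓ) (hs : SignsL c α₂ B₃) (hd : 0 < d) :
    RemainderConst S γ (c.ε₁ * remCoeffL d M c α₂ B₃) :=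
  (R.toChainTFac hE hV).abs_beta1_le hC h22 hs hd

/-- The one-sided form `−ε₁K_rem,L ≤ β¹_{k+1}` on the boxes (the only half the endpoint statement uses). [folklore] -/
theorem neg_le_beta1 (R : ResidualChain d M μ ν S γ c ℓ α₂ 𝔈) {B₃ : ℝ} (hE : ∀ k, (𝔈 k).Decay B₃ c.δ₀)
    (hV : ∀ k, (𝔈 k).Limit) (hC : CondsL d c ℓ) (h22 : c.R22gen ℓ) (hs : SignsL c α₂ B₃) (hd : 0 < d) :
    ∀ k (p : Fin (k + 1) → ℝ), p ∈ B12Beta.HistBox γ k → -(c.ε₁ * remCoeffL d M c α₂ B₃) ≤ S.β1 k p :=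
  fun k p hp => (abs_le.mp (R.abs_beta1_le hE hV hC h22 hs hd k p hp)).1

/-- **THE END with per-level constants and a majorant** («CAP rows + monotone majorant» form of (E)): per-scale decay
pairs `(Bk k, δk k)` dominated by `(B₃, δ₀)` with `c.δ₀ = δ₀`. [folklore] -/
theorem abs_beta1_le_of_levelwise (R : ResidualChain d M μ ν S γ c ℓ α₂ 𝔈) {Bk δk : ℕ → ℝ} {B₃ : ℝ}
    (hEk : ∀ k, (𝔈 k).Decay (Bk k) (δk k)) (hB : ∀ k, Bk k ≤ B₃) (hδ : ∀ k, c.δ₀ ≤ δk k)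
    (hV : ∀ k, (𝔈 k).Limit) (hC : CondsL d c ℓ) (h22 : c.R22gen ℓ) (hs : SignsL c α₂ B₃) (hd : 0 < d) :
    RemainderConst S γ (c.ε₁ * remCoeffL d M c α₂ B₃) :=
  R.abs_beta1_le (ExplicitCarrier.Decay.uniform_of_levelwise hEk hB hs.B₃_nonneg hδ hs.δ₀_pos.le) hV hC h22 hs hd

end ResidualChain

/-! ## §4 IN THE WALL'S LETTERS: the (D4) pair of `OneStepKernelFamily.endpointExistence_of_D1Drift` from road P3 -/

section Wall

open Beta.OneStepKernelFamily (TbalOf D1Drift endpointExistence_of_D1Drift)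
open B12Beta (secondMoment)
open Beta.OneStepResolventKernel (JetData)

variable {M : ℕ} [NeZero M]

/-- **THE (D4) PAIR OF THE WALL FROM ROAD P3** (d = 4): the residual (R), the explicit carrier's decay (E) and volume limit
(V), the numeric conditions, and the printed-type restriction `ε₁ · K_rem,L ≤ stepBal N Lc` on ε₁ give EXACTLY the binders
`(hrem, hr)` of `OneStepKernelFamily.endpointExistence_of_D1Drift` with `rr := c.ε₁ · remCoeffL 4 M c α₂ B₃`. [folklore] -/
theorem wallPair_of_residualChain {μ ν : Fin 4} {β : HBeta} {Sβ : B12Beta.OneLoopSplit β} {γ₀ : ℝ}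
    {c : B13.Consts} {ℓ α₂ B₃ : ℝ} {𝔈 : ℕ → ExplicitCarrier 4 M}
    (R : ResidualChain 4 M μ ν Sβ γ₀ c ℓ α₂ 𝔈) (hE : ∀ k, (𝔈 k).Decay B₃ c.δ₀) (hV : ∀ k, (𝔈 k).Limit)
    (hC : CondsL 4 c ℓ) (h22 : c.R22gen ℓ) (hs : SignsL c α₂ B₃) {N : ℝ} {Lc : ℕ}
    (hr : c.ε₁ * remCoeffL 4 M c α₂ B₃ ≤ B12Normalization.stepBal N Lc) :
    RemainderConst Sβ γ₀ (c.ε₁ * remCoeffL 4 M c α₂ B₃) ∧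
      c.ε₁ * remCoeffL 4 M c α₂ B₃ ≤ B12Normalization.stepBal N Lc :=
  ⟨R.abs_beta1_le hE hV hC h22 hs (by norm_num), hr⟩

/-- **THE WALL'S END WITH ITS (D4) PAIR SUPPLIED BY ROAD P3**: `OneStepKernelFamily.endpointExistence_of_D1Drift` with
`hrem` := `ResidualChain.abs_beta1_le`.  What remains, exactly: the wall's own binders (`hgen`, `Sβ`, `Js`, row D1's `hβ` and
`D1Drift`, continuity (C)), road P3's (R) ∧ (E) ∧ (V), the numeric conditions and `hr`.  Discharges nothing of `BetaPertH`
by itself. [folklore] -/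
theorem endpointExistence_of_residualChain_D1Drift {Lc : ℕ} [NeZero Lc] {β : HBeta} {Cn : B12.Construction}
    (hgen : ForwardGenerated Cn β) (Sβ : B12Beta.OneLoopSplit β) (Js : ℕ → JetData 3 Lc) {N : ℝ} {μ ν : Fin 4}
    (hβ : ∀ j, Sβ.β0 j = secondMoment (TbalOf Lc Js j) μ ν) (hD : D1Drift Lc Js N μ ν)
    {γ₀ : ℝ} (hγ₀ : 0 < γ₀) {c : B13.Consts} {ℓ α₂ B₃ : ℝ} {𝔈 : ℕ → ExplicitCarrier 4 M}
    (R : ResidualChain 4 M μ ν Sβ γ₀ c ℓ α₂ 𝔈) (hE : ∀ k, (𝔈 k).Decay B₃ c.δ₀) (hV : ∀ k, (𝔈 k).Limit)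
    (hC : CondsL 4 c ℓ) (h22 : c.R22gen ℓ) (hs : SignsL c α₂ B₃)
    (hr : c.ε₁ * remCoeffL 4 M c α₂ B₃ ≤ B12Normalization.stepBal N Lc) (hcont : BetaContH γ₀ β) :
    EndpointExistence Cn :=
  endpointExistence_of_D1Drift hgen Sβ Js hβ hD hγ₀ (R.abs_beta1_le hE hV hC h22 hs (by norm_num)) hr hcont

end Wall

end

end Summit.QuantumFields.BalabanUV.Beta.RemainderExplicitRoad
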